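import Mathlib
import HarnessLib
import Summits.RiemannHypothesis.RiemannHypothesis.Theorems.IntegerScrewWalkGapSharp

/-!
# Route `IntegerScrew` — the SPECTRAL GAP of the truncated multiplicative walk is STRICTLY BELOW `2 log 2/L`,
# with an explicit `O(1/L²)` deficit (PIVOT-LAW 13.10 (iv); CONTINUUM-LIMIT 23.18 (f))

`−walkGen M` is a non-negative self-adjoint operator on `ℓ²(π)`, `π(k) ∝ 1/k` (`IntegerScrewWalkDirichlet`), whose
gap is `min {E(g)/‖g‖²_π : g ⊥_π 1, g ≠ 0}` and tends (in `t = Lτ` units) to the atom `2 log 2` of the prime-parity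
ladder.  With the centred 2-parity test function of `IntegerScrewParityGap.parity_test_function`:

* **`walk_gap_lt`** — `M ≥ 7`: some `g ⊥_π 1`, `g ≠ 0` has `E(g) < (2 log 2/log M)‖g‖²_π`, so **gap < 2 log 2/log M**;
* **`walk_gap_le`** — `M ≥ 20`: `E(g) ≤ (2 log 2/L − log 2/(3L(L+1)))‖g‖²_π`, `L = log M`; i.e. the gap eigenvalue in
  `t`-units obeys `Λ_{2}(L) ≤ 2 log 2 − (log 2/3)/(L + 1)` — an explicit NEGATIVE finite-size correction
  (WALK-LADDER §7: `Λ_{2} = 1.3423` at `L = 31 log 2 ≈ 21.5`, vs `2 log 2 = 1.3863` and this bound's `1.3760`);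
* **`walk_gap_le_asymp`** — the first-order SHARP version (from `IntegerScrewWalkGapSharp.walk_gap_le_sharp`): for every
  `ε > 0`, eventually in `M`, `E(g) ≤ (2 log 2/L − (2 log²2 − ε)/L²)‖g‖²_π`; i.e. `liminf_L L(2 log 2 − L·gap) ≥ 2 log²2 =
  δ^σ_{2}(∞) = 0.961`, the σ-model's first-order depth of the `{2}` atom (CONTINUUM-LIMIT 23.18 (a),(f),(i)).

RH-free.  References: PIVOT-LAW §13.10 (iv), CONTINUUM-LIMIT §23.18 (rh-explicit A6-PIVOT); M. Suzuki, J. Lond.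
Math. Soc. (2) 108 (2023) 1448–1487 [Suzuki2023].
-/

noncomputable section

set_option linter.dupNamespace false -- D-0017: `Summit.<S>.<S>.…` is the designed namespace

namespace Summit.RiemannHypothesis.RiemannHypothesis.Theorems.IntegerScrew

open Finset ArithmeticFunction Filter Topology

/-- **The spectral gap of the truncated multiplicative walk is strictly below `2 log 2/log M`** (`M ≥ 7`): the
centred 2-parity function `g` of `parity_test_function` has `E(g) < (2 log 2/log M)·‖g‖²_π` (`H_M > 2` for
`M ≥ 7`).  By the min–max principle for the `π`-self-adjoint `−walkGen M` (`IntegerScrewWalkDirichlet`),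
`gap(−walkGen M) < 2log 2/log M = λ_{2}/L`. -/
theorem walk_gap_lt {M : ℕ} (hM : 7 ≤ M) :
    ∃ g : St M → ℝ, (∑ k : St M, g k / (k : ℕ) = 0) ∧ (∃ k : St M, g k ≠ 0) ∧
      -(∑ k : St M, g k / (k : ℕ) * ∑ j : St M, walkGen M k j * g j) <
        (2 * Real.log 2 / Real.log M) * ∑ k : St M, g k ^ 2 / (k : ℕ) := by
  obtain ⟨g, h0, hne, -, hE⟩ := parity_test_function (M := M) (by omega)
  refine ⟨g, h0, hne, lt_of_le_of_lt hE ?_⟩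
  have hL : 0 < Real.log M := Real.log_pos (by exact_mod_cast (show 1 < M by omega))
  have hlog2 : 0 < Real.log 2 := Real.log_pos one_lt_two
  -- H_M > 2 (log 8 > 2)
  have hH2 : 2 < ∑ k : St M, (1 : ℝ) / (k : ℕ) := by
    have h := log_succ_le_harmonicSum M
    rw [← Finset.sum_coe_sort (Finset.Icc 1 M) (fun k => (1 : ℝ) / k)] at h
    have h8 : (2 : ℝ) < Real.log ((M : ℝ) + 1) := by
      have hM8 : (8 : ℝ) ≤ (M : ℝ) + 1 := by exact_mod_cast (show 8 ≤ M + 1 by omega)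
      have he : Real.exp 2 < 8 := by
        have h1 := Real.exp_one_lt_d9
        have : Real.exp 2 = Real.exp 1 * Real.exp 1 := by rw [← Real.exp_add]; norm_num
        rw [this]; nlinarith [Real.exp_pos (1 : ℝ)]
      calc (2 : ℝ) = Real.log (Real.exp 2) := (Real.log_exp 2).symm
        _ < Real.log 8 := Real.log_lt_log (Real.exp_pos _) he
        _ ≤ Real.log ((M : ℝ) + 1) := Real.log_le_log (by norm_num) hM8
    linarith
  have hpos : 0 < Real.log 2 / 4 - Real.log 2 / (2 * ∑ k : St M, (1 : ℝ) / (k : ℕ)) := by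
    rw [sub_pos, div_lt_div_iff_of_pos_left hlog2 (by positivity) (by norm_num)]; linarith
  have : 0 < (1 / Real.log M) * (Real.log 2 / 4 - Real.log 2 / (2 * ∑ k : St M, (1 : ℝ) / (k : ℕ))) := by
    positivity
  linarith

/-- **Quantitative gap deficit** (`M ≥ 20`, so `H_M ≥ 3`): the centred 2-parity function has Rayleigh quotient
`≤ 2 log 2/L − log 2/(3L(L+1))`, `L = log M`; i.e. in `t`-units the gap eigenvalue `Λ_{2}(L) = L·gap` obeys
`Λ_{2}(L) ≤ 2 log 2 − (log 2/3)/(L+1)` — an explicit NEGATIVE `O(1/L)` finite-size correction to the atom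
`2 log 2` (CONTINUUM-LIMIT 23.18 (f); WALK-LADDER: `Λ_{2} = 1.3423` at `L = 31 log 2` vs `2 log 2 = 1.3863`). -/
theorem walk_gap_le {M : ℕ} (hM : 20 ≤ M) :
    ∃ g : St M → ℝ, (∑ k : St M, g k / (k : ℕ) = 0) ∧ (∃ k : St M, g k ≠ 0) ∧
      -(∑ k : St M, g k / (k : ℕ) * ∑ j : St M, walkGen M k j * g j) ≤
        (2 * Real.log 2 / Real.log M - Real.log 2 / (3 * Real.log M * (Real.log M + 1))) *
          ∑ k : St M, g k ^ 2 / (k : ℕ) := by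
  obtain ⟨g, h0, hne, hV, hE⟩ := parity_test_function (M := M) (by omega)
  refine ⟨g, h0, hne, hE.trans ?_⟩
  have hL : 0 < Real.log M := Real.log_pos (by exact_mod_cast (show 1 < M by omega))
  have hlog2 : 0 < Real.log 2 := Real.log_pos one_lt_two
  set H : ℝ := ∑ k : St M, (1 : ℝ) / (k : ℕ) with hHdef
  set W : ℝ := ∑ k : St M, g k ^ 2 / (k : ℕ) with hW
  -- 3 ≤ H ≤ log M + 1
  have hHI : ∑ m ∈ Icc 1 M, (1 : ℝ) / m = H := by
    rw [hHdef, Finset.sum_coe_sort (Finset.Icc 1 M) (fun k => (1 : ℝ) / k)]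
  have hH3 : 3 ≤ H := by
    have h := log_succ_le_harmonicSum M
    have h21 : (3 : ℝ) ≤ Real.log ((M : ℝ) + 1) := by
      have hM21 : (21 : ℝ) ≤ (M : ℝ) + 1 := by exact_mod_cast (show 21 ≤ M + 1 by omega)
      have he : Real.exp 3 < 21 := by
        have h1 := Real.exp_one_lt_d9
        have : Real.exp 3 = Real.exp 1 * Real.exp 1 * Real.exp 1 := by rw [← Real.exp_add, ← Real.exp_add]; norm_num
        rw [this]; nlinarith [Real.exp_pos (1 : ℝ), mul_pos (Real.exp_pos (1 : ℝ)) (Real.exp_pos (1 : ℝ))]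
      calc (3 : ℝ) = Real.log (Real.exp 3) := (Real.log_exp 3).symm
        _ ≤ Real.log 21 := Real.log_le_log (Real.exp_pos _) he.le
        _ ≤ Real.log ((M : ℝ) + 1) := Real.log_le_log (by norm_num) hM21
    linarith
  have hHle : H ≤ Real.log M + 1 := by rw [← hHI]; exact harmonicSum_le_log_add_one (by omega)
  have hH0 : 0 < H := by linarith
  have hW0 : 0 ≤ W := Finset.sum_nonneg fun k _ => by positivity
  -- the deficit: log 2/4 − log 2/(2H) ≥ log 2/12 ≥ (log 2/12)·(4W/(L+1)) = log 2·W/(3(L+1))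
  have hdef : Real.log 2 / 12 ≤ Real.log 2 / 4 - Real.log 2 / (2 * H) := by
    have : Real.log 2 / (2 * H) ≤ Real.log 2 / 6 := div_le_div_of_nonneg_left hlog2.le (by norm_num) (by linarith)
    linarith
  have hWle : W ≤ (Real.log M + 1) / 4 := hV.trans (by linarith)
  have hL1 : 0 < Real.log M + 1 := by linarith
  have key : Real.log 2 / (3 * Real.log M * (Real.log M + 1)) * W ≤
      (1 / Real.log M) * (Real.log 2 / 4 - Real.log 2 / (2 * H)) := by
    calc Real.log 2 / (3 * Real.log M * (Real.log M + 1)) * W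
        ≤ Real.log 2 / (3 * Real.log M * (Real.log M + 1)) * ((Real.log M + 1) / 4) :=
          mul_le_mul_of_nonneg_left hWle (by positivity)
      _ = (1 / Real.log M) * (Real.log 2 / 12) := by field_simp; ring
      _ ≤ (1 / Real.log M) * (Real.log 2 / 4 - Real.log 2 / (2 * H)) :=
          mul_le_mul_of_nonneg_left hdef (by positivity)
  rw [sub_mul]
  linarith

/-- **First-order sharp gap deficit, asymptotic form.**  For every `ε > 0`, for all large `M` some `g ⊥_π 1`, `g ≠ 0`
has `E(g) ≤ (2 log 2/L − (2 log²2 − ε)/L²)·‖g‖²_π` (`L = log M`): in `t`-units `L·gap(−ℒ_M) ≤ 2 log 2 − (2 log²2 − ε)/L`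
eventually, so `liminf_L L·(2 log 2 − L·gap) ≥ 2 log² 2 = δ^σ_{2}(∞)` (CONTINUUM-LIMIT 23.18 (i)). -/
theorem walk_gap_le_asymp {ε : ℝ} (hε : 0 < ε) :
    ∀ᶠ M : ℕ in atTop, ∃ g : St M → ℝ, (∑ k : St M, g k / (k : ℕ) = 0) ∧ (∃ k : St M, g k ≠ 0) ∧
      -(∑ k : St M, g k / (k : ℕ) * ∑ j : St M, walkGen M k j * g j) ≤
        (2 * Real.log 2 / Real.log M - (2 * Real.log 2 ^ 2 - ε) / Real.log M ^ 2) *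
          ∑ k : St M, g k ^ 2 / (k : ℕ) := by
  have hlog2 : 0 < Real.log 2 := Real.log_pos one_lt_two
  -- L_M → ∞, hence 1/L_M → 0 and L/(L+1) → 1
  have hL : Tendsto (fun M : ℕ => Real.log (M : ℝ)) atTop atTop :=
    Real.tendsto_log_atTop.comp tendsto_natCast_atTop_atTop
  have hLinv : Tendsto (fun M : ℕ => (Real.log (M : ℝ))⁻¹) atTop (𝓝 0) := hL.inv_tendsto_atTop
  have hL1inv : Tendsto (fun M : ℕ => (Real.log (M : ℝ) + 1)⁻¹) atTop (𝓝 0) :=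
    (tendsto_atTop_add_const_right _ 1 hL).inv_tendsto_atTop
  -- u_M = log 2·(⌊log₂M⌋ + 2)/M → 0 (squeezed by (log M + 2 log 2)/M)
  have hu : Tendsto (fun M : ℕ => Real.log 2 * ((Nat.log 2 M : ℝ) + 2) / M) atTop (𝓝 0) := by
    have h1 : Tendsto (fun x : ℝ => Real.log x / x) atTop (𝓝 0) := by
      have h := Real.tendsto_pow_log_div_mul_add_atTop 1 0 1 one_ne_zero
      refine h.congr' (Eventually.of_forall fun x => ?_)
      simp
    have h2 : Tendsto (fun M : ℕ => Real.log (M : ℝ) / (M : ℝ) + 2 * Real.log 2 / (M : ℝ)) atTop (𝓝 0) := by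
      have := (h1.comp tendsto_natCast_atTop_atTop).add (tendsto_const_div_atTop_nhds_zero_nat (2 * Real.log 2))
      simpa using this
    refine squeeze_zero' ?_ ?_ h2
    · filter_upwards [eventually_ge_atTop 1] with M hM
      positivity
    · filter_upwards [eventually_ge_atTop 1] with M hM
      have hM0 : (0 : ℝ) < M := by exact_mod_cast hM
      -- log 2 · ⌊log₂M⌋ ≤ log M
      have hj : Real.log 2 * (Nat.log 2 M : ℝ) ≤ Real.log M := by
        have h := Nat.pow_log_le_self 2 (show M ≠ 0 by omega)
        have h' : ((2 : ℝ) ^ Nat.log 2 M) ≤ (M : ℝ) := by exact_mod_cast h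
        have := Real.log_le_log (by positivity) h'
        rwa [Real.log_pow, mul_comm] at this
      rw [← add_div, div_le_div_iff_of_pos_right hM0]
      nlinarith
  -- the coefficient of walk_gap_le_sharp, times L², tends to 2 log²2
  have hcoef : Tendsto (fun M : ℕ => (2 * Real.log 2 ^ 2 - 2 * Real.log 2 * (Real.log (M : ℝ))⁻¹ -
      4 * (Real.log 2 * ((Nat.log 2 M : ℝ) + 2) / M)) * (1 - (Real.log (M : ℝ) + 1)⁻¹)) atTop
      (𝓝 ((2 * Real.log 2 ^ 2 - 2 * Real.log 2 * 0 - 4 * 0) * (1 - 0))) :=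
    ((tendsto_const_nhds.sub (tendsto_const_nhds.mul hLinv)).sub (tendsto_const_nhds.mul hu)).mul
      (tendsto_const_nhds.sub hL1inv)
  simp only [mul_zero, sub_zero, mul_one] at hcoef
  have hev : ∀ᶠ M : ℕ in atTop, 2 * Real.log 2 ^ 2 - ε <
      (2 * Real.log 2 ^ 2 - 2 * Real.log 2 * (Real.log (M : ℝ))⁻¹ - 4 * (Real.log 2 * ((Nat.log 2 M : ℝ) + 2) / M)) *
        (1 - (Real.log (M : ℝ) + 1)⁻¹) :=
    hcoef.eventually (lt_mem_nhds (by linarith))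
  filter_upwards [hev, eventually_ge_atTop 64] with M hM hM64
  obtain ⟨g, h0, hne, hE⟩ := walk_gap_le_sharp hM64
  refine ⟨g, h0, hne, hE.trans ?_⟩
  have hLpos : 0 < Real.log (M : ℝ) := Real.log_pos (by exact_mod_cast (show 1 < M by omega))
  set L := Real.log (M : ℝ) with hLdef
  set W : ℝ := ∑ k : St M, g k ^ 2 / (k : ℕ) with hW
  have hW0 : 0 ≤ W := Finset.sum_nonneg fun k _ => by positivity
  -- the sharp coefficient dominates (2log²2 − ε)/L²
  have hdom : (2 * Real.log 2 ^ 2 - ε) / L ^ 2 ≤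
      (2 * Real.log 2 ^ 2 - 2 * Real.log 2 / L - 4 * Real.log 2 * ((Nat.log 2 M : ℝ) + 2) / M) / (L * (L + 1)) := by
    have e1 : (2 * Real.log 2 ^ 2 - 2 * Real.log 2 / L - 4 * Real.log 2 * ((Nat.log 2 M : ℝ) + 2) / M) / (L * (L + 1)) =
        ((2 * Real.log 2 ^ 2 - 2 * Real.log 2 * L⁻¹ - 4 * (Real.log 2 * ((Nat.log 2 M : ℝ) + 2) / M)) *
          (1 - (L + 1)⁻¹)) / L ^ 2 := by
      field_simp
      ring
    rw [e1]
    exact div_le_div_of_nonneg_right hM.le (by positivity)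
  have := mul_le_mul_of_nonneg_right hdom hW0
  rw [sub_mul, sub_mul]
  linarith

end Summit.RiemannHypothesis.RiemannHypothesis.Theorems.IntegerScrew

end
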